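import Summits.NavierStokesRegularity.NavierStokesRegularity.Theorems.AxisymmetricExtremalityAxisymmetricKatoGlobalStubSeregin2020TypeIIMoserB
import HarnessLib

/-!
# Seregin 2020, proof of Thm 2.1: the basic estimate (2.3) and its absorption, at a fixed truncation

Helper toward the stub `stub_seregin2020TypeII` of the crux `AxisymmetricKatoGlobal` (= the named
fact `Literature.Analysis.FluidPDE.Seregin2020_axisymmetricSingularPoint_typeII`, G. Seregin,
Anal. Math. Phys. 10 (2020) Paper 46 = arXiv:2006.04140, Thm 2.1). After the removal of the axis
cut-off (sibling module `…MoserB`), the printed proof (arXiv pp. 6–7) picks `ψ = Φ(x)χ(t)` with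
`|∇Φ| ≤ c/(r₁-r)`, `|∂ₜχ| ≤ c/(r₁-r)²`, derives "the basic estimate" (2.3)
`|ψ²ω_N|²_{2,Q} ≤ c(r₁-r)⁻² ∫_{Q(r₁)} ψ²ωω_N + cJ₁ + cJ₂`, bounds `J₁` by the three-factor Hölder
inequality `(10/3, 5/2, 10/3)` against `M = (∫|v|^{10/3})^{3/10}`, and absorbs the `L^{10/3}` norm of
`ψ²ω_N` "after application of the Young inequality". This file proves that chain at a FIXED
truncation level for the tree's form of the argument (profile `s ≤ (1+τ²)^{m/2} - 1`, `H = s²`,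
`H ≤ Lτ²` of `Seregin2020.exists_moserProfile`; radial cut-off, so the drift term `J₂` is absent —
`∂_ϱΦ ≤ 0` —, and the estimate holds for every `m ≥ 0` at once):

* `moser_main_pointwise` — the integrand of the `ε`-free right-hand side is at most
  `(8C_Φ² + 2C_T)(r₁-r)⁻² ω² + 2C_Φ(r₁-r)⁻¹ |V| ω |χΦs(σ)|`, `ω = (1+σ²)^{m/2}`;
* `swirl_moser_truncated_le` (registered sub-goal) — for `(V, P)` in the Seregin–Zajaczkowski class
  off the axis on `]lo, 0[ × U`, `0 ≤ r < r₁ ≤ 1`: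
  `‖χ Φ s(σ)‖_{L^{10/3}(]-r₁²,0[×ℝ³)} ≤ K(C_Φ,C_T) (1 + ‖V‖_{L^{10/3}(Q̄(r₁))}) (r₁-r)⁻¹ ‖ω‖_{L^{5/2}(Q̄(r₁))}`,
  `Q̄(r₁) = ]-r₁², 0[ × B̄(0, r₁)` (the `ε`-free bound, the pointwise bound, Hölder, finiteness of
  the left-hand side from `s(σ) ≤ √L|σ| ≤ √L|V|`, and `Y² ≤ c(a + bY) ⇒ Y ≤ √(2ca) + cb`).

## References

* G. Seregin, Anal. Math. Phys. 10 (2020), Paper 46 = arXiv:2006.04140, proof of Thm. 2.1,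
  (2.3)–(2.5), Steps I–II (arXiv pp. 6–7). [Seregin2020]
-/

-- the problem directory repeats the summit name (D-0017); core's `dupNamespace` linter fires
set_option linter.dupNamespace false

noncomputable section

open MeasureTheory Set Function Filter Topology TopologicalSpace Metric
open scoped NNReal ENNReal InnerProductSpace RealInnerProductSpace

namespace Summit.NavierStokesRegularity.NavierStokesRegularity.Theorems.AxisymmetricKatoGlobal.EulerScaling

open Literature.Analysis.FluidPDE Literature.Analysis.FluidPDE.SereginZajaczkowski2007
  Literature.Analysis.FluidPDE.SereginSverak2009 Literature.Analysis.FluidPDE.Seregin2020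
  Literature.Analysis.FluidPDE.LeiZhang2011

/-! ### The pointwise bound of the `ε`-free integrand -/

/-- **The integrand of (2.3), pointwise**: with `0 ≤ s ≤ ω`, `|χ| ≤ 1`, `0 ≤ Φ ≤ 1`,
`|∇Φ| ≤ C_Φ D`, `|η'| ≤ 2C_T D²` (`D = (r₁ - r)⁻¹`),
`s²(8χ²|∇Φ|² + 2χ²|V|Φ|∇Φ| + |η'|Φ²) ≤ (8C_Φ² + 2C_T)D² ω² + 2C_ΦD |V| ω |χΦs|` (the terms
`c(r₁-r)⁻² ψ²ωω_N` and `J₁` of the basic estimate (2.3)).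
[cite: Seregin2020, proof of Thm 2.1, the basic estimate (2.3) (arXiv p. 6)] -/
theorem moser_main_pointwise {s ω χ Φ gΦ dη v CΦ CT D : ℝ}
    (hs0 : 0 ≤ s) (hsω : s ≤ ω) (hχ : |χ| ≤ 1) (hΦ0 : 0 ≤ Φ) (hΦ1 : Φ ≤ 1)
    (hgΦ0 : 0 ≤ gΦ) (hgΦ : gΦ ≤ CΦ * D) (hdη0 : 0 ≤ dη) (hdη : dη ≤ 2 * CT * D ^ 2) (hv : 0 ≤ v) :
    s ^ 2 * (8 * χ ^ 2 * gΦ ^ 2 + 2 * χ ^ 2 * (v * (Φ * gΦ)) + dη * Φ ^ 2) ≤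
      (8 * CΦ ^ 2 + 2 * CT) * D ^ 2 * ω ^ 2 + 2 * CΦ * D * (v * ω * |χ * (Φ * s)|) := by
  have hω : 0 ≤ ω := hs0.trans hsω
  have hχ0 : 0 ≤ |χ| := abs_nonneg _
  have hχ2 : χ ^ 2 ≤ 1 := by rw [← sq_abs]; exact pow_le_one₀ hχ0 hχ
  have hs2 : s ^ 2 ≤ ω ^ 2 := pow_le_pow_left₀ hs0 hsω 2
  have hCD : 0 ≤ CΦ * D := hgΦ0.trans hgΦ
  have hg2 : gΦ ^ 2 ≤ (CΦ * D) ^ 2 := pow_le_pow_left₀ hgΦ0 hgΦ 2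
  -- first term
  have t1 : s ^ 2 * (8 * χ ^ 2 * gΦ ^ 2) ≤ 8 * CΦ ^ 2 * D ^ 2 * ω ^ 2 := by
    have a : χ ^ 2 * gΦ ^ 2 ≤ 1 * (CΦ * D) ^ 2 := mul_le_mul hχ2 hg2 (sq_nonneg _) zero_le_one
    have b : s ^ 2 * (χ ^ 2 * gΦ ^ 2) ≤ ω ^ 2 * (1 * (CΦ * D) ^ 2) :=
      mul_le_mul hs2 a (mul_nonneg (sq_nonneg _) (sq_nonneg _)) (sq_nonneg _)
    nlinarith [b]
  -- third term
  have t3 : s ^ 2 * (dη * Φ ^ 2) ≤ 2 * CT * D ^ 2 * ω ^ 2 := by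
    have a : dη * Φ ^ 2 ≤ 2 * CT * D ^ 2 * 1 := mul_le_mul hdη (pow_le_one₀ hΦ0 hΦ1) (sq_nonneg _) (hdη0.trans hdη)
    have b : s ^ 2 * (dη * Φ ^ 2) ≤ ω ^ 2 * (2 * CT * D ^ 2 * 1) :=
      mul_le_mul hs2 a (mul_nonneg hdη0 (sq_nonneg _)) (sq_nonneg _)
    nlinarith [b]
  -- second term: `s²χ²vΦgΦ = (|χ|Φs)(|χ|s) v gΦ ≤ |χΦs| ω v C_Φ D`
  have t2 : s ^ 2 * (2 * χ ^ 2 * (v * (Φ * gΦ))) ≤ 2 * CΦ * D * (v * ω * |χ * (Φ * s)|) := by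
    have habs : |χ * (Φ * s)| = |χ| * (Φ * s) := by rw [abs_mul, abs_of_nonneg (mul_nonneg hΦ0 hs0)]
    rw [habs, show χ ^ 2 = |χ| ^ 2 from (sq_abs χ).symm]
    have a : |χ| * s ≤ 1 * ω := mul_le_mul hχ hsω hs0 zero_le_one
    have b : (|χ| * s) * gΦ ≤ (1 * ω) * (CΦ * D) := mul_le_mul a hgΦ hgΦ0 (by positivity)
    have c : 0 ≤ 2 * |χ| * Φ * s * v := by positivity
    have d := mul_le_mul_of_nonneg_left b c
    nlinarith [d]
  nlinarith [t1, t2, t3]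

/-! ### The estimate at a fixed truncation level -/

/-- **The basic estimate (2.3) with `J₁` by Hölder and the absorption, at a fixed truncation**
(Seregin 2020, proof of Thm 2.1, (2.3)–(2.5), arXiv pp. 6–7). Setting: `(V, P)` in the
Seregin–Zajaczkowski class on `S = ]lo, 0[ × U`, `U` open, off the axis, rotation invariant,
containing the off-axis points of `B̄(0,r₁)`; `0 ≤ r < r₁ ≤ 1`, `lo < -r₁²`; the radial cut-off
`Φ = radialCutoff r r₁` with `|∇Φ| ≤ C_Φ/(r₁-r)`, the time cut-off `χ(s) = smoothTransition((s+r₁²)/(r₁²-r²))`;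
a profile `s ∈ C²`, `H = s²`, `s ≥ 0`, `2s'² ≤ H''`, `H'² ≤ 2HH''`, `s ≤ (1+τ²)^{m/2} - 1`, `H ≤ Lτ²`;
and `V ∈ L^{10/3}(Q̄(r₁))`, `Q̄(r₁) = ]-r₁²,0[ × B̄(0,r₁)`. Then, with `ω = (1+σ²)^{m/2}`,
`‖χΦs(σ)‖_{L^{10/3}} ≤ (K_a + K_b)(1 + ‖V‖_{L^{10/3}(Q̄(r₁))}) (r₁-r)⁻¹ ‖ω‖_{L^{5/2}(Q̄(r₁))}`,
`K_a = (2c ofReal(8C_Φ²+2C_T) |B̄(0,1)|^{1/5})^{1/2}`, `K_b = c·ofReal(2C_Φ)`, `c = (3C_S²)^{3/5}`.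
[cite: Seregin2020, proof of Thm 2.1, (2.3)–(2.5) (arXiv pp. 6–7)] -/
theorem swirl_moser_truncated_le :
    ∀ (V : ℝ → EuclideanSpace ℝ (Fin 3) → EuclideanSpace ℝ (Fin 3)) (P : ℝ → EuclideanSpace ℝ (Fin 3) → ℝ)
      (S : TopologicalSpace.Opens (ℝ × EuclideanSpace ℝ (Fin 3))) (lo : ℝ) (U : Set (EuclideanSpace ℝ (Fin 3))),
      IsOpen U → (S : Set (ℝ × EuclideanSpace ℝ (Fin 3))) = Ioo lo 0 ×ˢ U →
      (∀ θ : ℝ, ∀ z ∈ (S : Set (ℝ × EuclideanSpace ℝ (Fin 3))),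
        SereginZajaczkowski2007.stRot θ z ∈ (S : Set (ℝ × EuclideanSpace ℝ (Fin 3)))) →
      (∀ x ∈ U, cylRadius x ≠ 0) → SereginZajaczkowski2007.IsSmoothAxisymmetricSolutionOn S V P →
    ∀ (m r r₁ : ℝ), 0 ≤ m → 0 ≤ r → r < r₁ → r₁ ≤ 1 → lo < -r₁ ^ 2 →
      (∀ x : EuclideanSpace ℝ (Fin 3), ‖x‖ ≤ r₁ → cylRadius x ≠ 0 → x ∈ U) →
    ∀ (CΦ CT : ℝ), 0 ≤ CΦ →
      (∀ z : EuclideanSpace ℝ (Fin 3), ‖gradient (radialCutoff r r₁ : EuclideanSpace ℝ (Fin 3) → ℝ) z‖ ≤ CΦ / (r₁ - r)) →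
      (∀ t, |deriv Real.smoothTransition t| ≤ CT) →
    ∀ (χ : ℝ → ℝ), (∀ s, χ s = Real.smoothTransition ((s + r₁ ^ 2) / (r₁ ^ 2 - r ^ 2))) →
    ∀ (sf H : ℝ → ℝ) (L : ℝ), 0 ≤ L → ContDiff ℝ 2 sf → ContDiff ℝ 2 H → (∀ τ, H τ = sf τ ^ 2) →
      (∀ τ, 0 ≤ sf τ) → (∀ τ, 2 * deriv sf τ ^ 2 ≤ deriv (deriv H) τ) →
      (∀ τ, deriv H τ ^ 2 ≤ 2 * H τ * deriv (deriv H) τ) →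
      (∀ τ, sf τ ≤ Real.sqrt (1 + τ ^ 2) ^ m - 1) → (∀ τ, H τ ≤ L * τ ^ 2) →
    (∫⁻ p in Ioo (-r₁ ^ 2) 0 ×ˢ Metric.closedBall (0 : EuclideanSpace ℝ (Fin 3)) r₁, ‖V p.1 p.2‖ₑ ^ (10 / 3 : ℝ)
      ∂((volume : Measure ℝ).prod (volume : Measure (EuclideanSpace ℝ (Fin 3))))) < ⊤ →
    (∫⁻ p, ‖χ p.1 * (radialCutoff r r₁ p.2 * sf (swirl (V p.1) p.2))‖ₑ ^ (10 / 3 : ℝ)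
        ∂((volume.restrict (Ioo (-r₁ ^ 2) 0)).prod volume)) ^ (3 / 10 : ℝ) ≤
      ((2 * (3 * (SNormLESNormFDerivOfEqConst ℝ (volume : Measure (EuclideanSpace ℝ (Fin 3))) 2 : ℝ≥0∞) ^ 2) ^ (3 / 5 : ℝ) *
            ENNReal.ofReal (8 * CΦ ^ 2 + 2 * CT) *
            volume (Metric.closedBall (0 : EuclideanSpace ℝ (Fin 3)) 1) ^ (1 / 5 : ℝ)) ^ (1 / 2 : ℝ) +
          (3 * (SNormLESNormFDerivOfEqConst ℝ (volume : Measure (EuclideanSpace ℝ (Fin 3))) 2 : ℝ≥0∞) ^ 2) ^ (3 / 5 : ℝ) *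
            ENNReal.ofReal (2 * CΦ)) *
        (1 + (∫⁻ p in Ioo (-r₁ ^ 2) 0 ×ˢ Metric.closedBall (0 : EuclideanSpace ℝ (Fin 3)) r₁, ‖V p.1 p.2‖ₑ ^ (10 / 3 : ℝ)
          ∂((volume : Measure ℝ).prod (volume : Measure (EuclideanSpace ℝ (Fin 3))))) ^ (3 / 10 : ℝ)) *
        ENNReal.ofReal ((r₁ - r)⁻¹) *
        (∫⁻ p in Ioo (-r₁ ^ 2) 0 ×ˢ Metric.closedBall (0 : EuclideanSpace ℝ (Fin 3)) r₁,
          ENNReal.ofReal (Real.sqrt (1 + swirl (V p.1) p.2 ^ 2) ^ m) ^ (5 / 2 : ℝ)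
          ∂((volume : Measure ℝ).prod (volume : Measure (EuclideanSpace ℝ (Fin 3))))) ^ (2 / 5 : ℝ) := by
  intro V P S lo U hU hSU hS hUρ hV m r r₁ hm hr hrr₁ hr₁ hlo hBU CΦ CT hCΦ0 hCΦ hCT χ hχ sf H L hL hsC hHC hHs hs0
    hs2 hκ hsle hHL hIV
  -- notation
  set C : ℝ≥0∞ := 3 * (SNormLESNormFDerivOfEqConst ℝ (volume : Measure (EuclideanSpace ℝ (Fin 3))) 2 : ℝ≥0∞) ^ 2 with hC
  set I : Set ℝ := Ioo (-r₁ ^ 2) 0 with hI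
  set μ' : Measure (ℝ × EuclideanSpace ℝ (Fin 3)) := (volume.restrict I).prod volume with hμ'
  set B : Set (EuclideanSpace ℝ (Fin 3)) := closedBall (0 : EuclideanSpace ℝ (Fin 3)) r₁ with hB
  set μB : Measure (ℝ × EuclideanSpace ℝ (Fin 3)) := μ'.restrict (univ ×ˢ B) with hμB
  have hμBe : μB = ((volume : Measure ℝ).prod (volume : Measure (EuclideanSpace ℝ (Fin 3)))).restrict (I ×ˢ B) := by
    rw [hμB, hμ', ← Measure.prod_restrict, Measure.restrict_univ, Measure.prod_restrict]
  set Φ : EuclideanSpace ℝ (Fin 3) → ℝ := radialCutoff r r₁ with hΦdef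
  set ω : ℝ × EuclideanSpace ℝ (Fin 3) → ℝ := fun p => Real.sqrt (1 + swirl (V p.1) p.2 ^ 2) ^ m with hω
  set g : ℝ × EuclideanSpace ℝ (Fin 3) → ℝ := fun p => χ p.1 * (Φ p.2 * sf (swirl (V p.1) p.2)) with hg
  set X : ℝ≥0∞ := ∫⁻ p, ‖g p‖ₑ ^ (10 / 3 : ℝ) ∂μ' with hX
  set I₂ : ℝ≥0∞ := ∫⁻ p, ENNReal.ofReal (ω p) ^ (5 / 2 : ℝ) ∂μB with hI₂
  set IV : ℝ≥0∞ := ∫⁻ p, ‖V p.1 p.2‖ₑ ^ (10 / 3 : ℝ) ∂μB with hIV'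
  set D : ℝ := (r₁ - r)⁻¹ with hD
  set V₁ : ℝ≥0∞ := volume (closedBall (0 : EuclideanSpace ℝ (Fin 3)) 1) with hV₁
  have eIV : (∫⁻ p in Ioo (-r₁ ^ 2) 0 ×ˢ closedBall (0 : EuclideanSpace ℝ (Fin 3)) r₁, ‖V p.1 p.2‖ₑ ^ (10 / 3 : ℝ)
      ∂((volume : Measure ℝ).prod (volume : Measure (EuclideanSpace ℝ (Fin 3))))) = IV := by rw [hIV', hμBe]
  have eI₂ : (∫⁻ p in Ioo (-r₁ ^ 2) 0 ×ˢ closedBall (0 : EuclideanSpace ℝ (Fin 3)) r₁,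
      ENNReal.ofReal (Real.sqrt (1 + swirl (V p.1) p.2 ^ 2) ^ m) ^ (5 / 2 : ℝ)
      ∂((volume : Measure ℝ).prod (volume : Measure (EuclideanSpace ℝ (Fin 3))))) = I₂ := by rw [hI₂, hμBe]
  rw [eIV, eI₂]
  have hIVfin : IV < ⊤ := eIV ▸ hIV
  -- elementary facts
  have hd0 : 0 < r₁ - r := sub_pos.2 hrr₁
  have hD0 : 0 ≤ D := inv_nonneg.2 hd0.le
  have hCT0 : 0 ≤ CT := (abs_nonneg _).trans (hCT 0)
  have hT : r ^ 2 < r₁ ^ 2 := by nlinarith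
  have hIoo : I ⊆ Ioo lo 0 := Ioo_subset_Ioo hlo.le le_rfl
  have hf1 : ∀ τ : ℝ, 1 ≤ Real.sqrt (1 + τ ^ 2) := fun τ => by
    rw [Real.le_sqrt zero_le_one (by positivity)]; nlinarith
  have hω1 : ∀ p, 1 ≤ ω p := fun p => Real.one_le_rpow (hf1 _) hm
  have hsω : ∀ p, sf (swirl (V p.1) p.2) ≤ ω p := fun p => (hsle _).trans (by simp only [hω]; linarith)
  -- the time cut-off
  obtain ⟨hχC, hχt, hχone, hχ01, hχd⟩ := timeCutoff_props hT hCT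
  have hχfun : (fun s : ℝ => Real.smoothTransition ((s + r₁ ^ 2) / (r₁ ^ 2 - r ^ 2))) = χ := (funext hχ).symm
  rw [hχfun] at hχC hχd
  simp only [← hχ] at hχt hχone hχ01
  have hχabs : ∀ s, |χ s| ≤ 1 := fun s => by rw [abs_of_nonneg (hχ01 s).1]; exact (hχ01 s).2
  have hη : ContDiff ℝ 1 (fun s => χ s ^ 2) := hχC.pow 2
  have hη1 : ∀ s, χ s ^ 2 ≤ 1 := fun s => pow_le_one₀ (hχ01 s).1 (hχ01 s).2
  have hηt : χ (-r₁ ^ 2) ^ 2 = 0 := by rw [hχt]; ring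
  have hdη : ∀ s, |deriv (fun s => χ s ^ 2) s| ≤ 2 * CT * D ^ 2 := by
    intro s
    have hd : deriv (fun s => χ s ^ 2) s = 2 * χ s * deriv χ s := by
      have h := (((hχC.differentiable one_ne_zero) s).hasDerivAt.pow 2).deriv
      simp only [Nat.cast_ofNat, pow_one, show (2 : ℕ) - 1 = 1 from rfl] at h
      exact h
    rw [hd, abs_mul, abs_mul, abs_two]
    have h1 : |deriv χ s| ≤ CT * D ^ 2 := by
      refine (hχd s).trans ?_
      rw [div_eq_mul_inv]
      refine mul_le_mul_of_nonneg_left ?_ hCT0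
      rw [hD, inv_pow]
      exact inv_anti₀ (pow_pos hd0 2) (by nlinarith)
    calc 2 * |χ s| * |deriv χ s| ≤ 2 * 1 * (CT * D ^ 2) :=
          mul_le_mul (mul_le_mul_of_nonneg_left (hχabs s) zero_le_two) h1 (abs_nonneg _) (by norm_num)
      _ = 2 * CT * D ^ 2 := by ring
  -- (1) the `ε`-free `L^{10/3}` bound
  have hA := swirl_moser_tenThirds_le_noAxisCutoff V P S lo 0 U hU hSU hS hUρ hV r r₁ hr hrr₁ hBU H sf hHC
    (hsC.of_le one_le_two) hHs hs2 hκ L hL hHL (fun s => χ s ^ 2) χ hη hχC.continuous (fun _ => rfl) hη1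
    (-r₁ ^ 2) hlo (by nlinarith) hηt hIV
  -- the `ε`-free integrand and right-hand side
  set Fm : ℝ × EuclideanSpace ℝ (Fin 3) → ℝ := fun p => H (swirl (V p.1) p.2) *
    (8 * χ p.1 ^ 2 * ‖gradient Φ p.2‖ ^ 2 + 2 * χ p.1 ^ 2 * (‖V p.1 p.2‖ * (Φ p.2 * ‖gradient Φ p.2‖)) +
      |deriv (fun s => χ s ^ 2) p.1| * Φ p.2 ^ 2) with hFm
  set ℛ₀ : ℝ≥0∞ := ∫⁻ p, ENNReal.ofReal (Fm p) ∂μ' with hℛ₀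
  replace hA : X ≤ C * ℛ₀ ^ (5 / 3 : ℝ) := hA
  -- (2) measurability on `μB`
  have hsub : I ×ˢ (B ∩ {x | cylRadius x ≠ 0}) ⊆ (S : Set (ℝ × EuclideanSpace ℝ (Fin 3))) := by
    rw [hSU]
    rintro p ⟨hp1, hp2, hp3⟩
    exact ⟨hIoo hp1, hBU _ (mem_closedBall_zero_iff.1 hp2) hp3⟩
  have hVM : AEMeasurable (fun p : ℝ × EuclideanSpace ℝ (Fin 3) => ‖V p.1 p.2‖ₑ) μB :=
    (aemeasurable_prod_restrict_of_continuousOn_offAxis measurableSet_Ioo measurableSet_closedBall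
      (hV.continuousOn_velocity.mono hsub)).enorm
  have hωc : ContinuousOn ω (S : Set (ℝ × EuclideanSpace ℝ (Fin 3))) :=
    (Real.continuous_sqrt.comp_continuousOn (continuousOn_const.add (hV.continuousOn_swirl.pow 2))).rpow_const
      fun _ _ => Or.inr hm
  have hωM : AEMeasurable (fun p => ENNReal.ofReal (ω p)) μB :=
    ENNReal.measurable_ofReal.comp_aemeasurable
      (aemeasurable_prod_restrict_of_continuousOn_offAxis measurableSet_Ioo measurableSet_closedBall (hωc.mono hsub))
  have hgc : ContinuousOn g (S : Set (ℝ × EuclideanSpace ℝ (Fin 3))) :=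
    (hχC.continuous.comp continuous_fst).continuousOn.mul
      (((radialCutoff_contDiff r r₁ (n := 0)).continuous.comp continuous_snd).continuousOn.mul
        (hsC.continuous.comp_continuousOn hV.continuousOn_swirl))
  have hgM : AEMeasurable (fun p => ‖g p‖ₑ) μB :=
    (aemeasurable_prod_restrict_of_continuousOn_offAxis measurableSet_Ioo measurableSet_closedBall (hgc.mono hsub)).enorm
  have hBm : MeasurableSet (univ ×ˢ B : Set (ℝ × EuclideanSpace ℝ (Fin 3))) := MeasurableSet.univ.prod measurableSet_closedBall
  -- (3) the pointwise bound of the `ε`-free integrand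
  have hpt : ∀ p, ENNReal.ofReal (Fm p) ≤
      ENNReal.ofReal ((8 * CΦ ^ 2 + 2 * CT) * D ^ 2) * (univ ×ˢ B).indicator (fun q => ENNReal.ofReal (ω q) ^ 2) p +
        ENNReal.ofReal (2 * CΦ * D) *
          (univ ×ˢ B).indicator (fun q => ‖V q.1 q.2‖ₑ * ENNReal.ofReal (ω q) * ‖g q‖ₑ) p := by
    intro p
    by_cases hp : p.2 ∈ B
    · have hpB : p ∈ univ ×ˢ B := ⟨mem_univ _, hp⟩
      rw [indicator_of_mem hpB, indicator_of_mem hpB]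
      have hgΦ : ‖gradient Φ p.2‖ ≤ CΦ * D := by rw [hD, ← div_eq_mul_inv]; exact hCΦ p.2
      have h := moser_main_pointwise (CT := CT) (hs0 (swirl (V p.1) p.2)) (hsω p) (hχabs p.1)
        (radialCutoff_nonneg r r₁ p.2) (radialCutoff_le_one r r₁ p.2) (norm_nonneg _) hgΦ (abs_nonneg _) (hdη p.1)
        (norm_nonneg (V p.1 p.2))
      have hω0 : 0 ≤ ω p := zero_le_one.trans (hω1 p)
      have hv0 : 0 ≤ ‖V p.1 p.2‖ := norm_nonneg _
      have hca : 0 ≤ (8 * CΦ ^ 2 + 2 * CT) * D ^ 2 := by positivity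
      have hcb : 0 ≤ 2 * CΦ * D := by positivity
      rw [hFm]
      dsimp only
      rw [hHs]
      refine (ENNReal.ofReal_le_ofReal h).trans (le_of_eq ?_)
      rw [ENNReal.ofReal_add (by positivity) (by positivity), ENNReal.ofReal_mul hca, ENNReal.ofReal_pow hω0,
        ENNReal.ofReal_mul hcb, ENNReal.ofReal_mul (mul_nonneg hv0 hω0), ENNReal.ofReal_mul hv0, ofReal_norm,
        ← Real.enorm_eq_ofReal_abs]
    · have hn : r₁ < ‖p.2‖ := not_le.1 fun h => hp (mem_closedBall_zero_iff.2 h)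
      have hΦ0 : Φ p.2 = 0 := radialCutoff_eq_zero hr hrr₁ hn.le
      have hgr : gradient Φ p.2 = 0 := gradient_eq_zero_of_notMem_tsupport fun h =>
        not_lt.2 (mem_closedBall_zero_iff.1 (tsupport_radialCutoff_subset hr hrr₁ h)) hn
      have h0 : Fm p = 0 := by simp only [hFm, hΦ0, hgr, norm_zero]; ring
      rw [h0, ENNReal.ofReal_zero]
      exact zero_le
  -- (4) integrate
  have hℛ : ℛ₀ ≤ ENNReal.ofReal ((8 * CΦ ^ 2 + 2 * CT) * D ^ 2) * ∫⁻ p, ENNReal.ofReal (ω p) ^ 2 ∂μB +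
      ENNReal.ofReal (2 * CΦ * D) * ∫⁻ p, ‖V p.1 p.2‖ₑ * ENNReal.ofReal (ω p) * ‖g p‖ₑ ∂μB := by
    have hm1 : AEMeasurable (fun p => ENNReal.ofReal ((8 * CΦ ^ 2 + 2 * CT) * D ^ 2) *
        (univ ×ˢ B).indicator (fun q => ENNReal.ofReal (ω q) ^ 2) p) μ' :=
      ((aemeasurable_indicator_iff hBm).2 (hωM.pow_const _)).const_mul _
    refine (lintegral_mono hpt).trans (le_of_eq ?_)
    rw [lintegral_add_left' hm1, lintegral_const_mul' _ _ ENNReal.ofReal_ne_top,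
      lintegral_const_mul' _ _ ENNReal.ofReal_ne_top, lintegral_indicator hBm, lintegral_indicator hBm]
  -- (5) Hölder
  have hμBuniv : μB univ ≤ V₁ := by
    rw [hμBe, Measure.restrict_apply_univ, Measure.prod_prod, Real.volume_Ioo]
    calc ENNReal.ofReal (0 - -r₁ ^ 2) * volume B ≤ 1 * V₁ :=
          mul_le_mul' (ENNReal.ofReal_le_one.2 (by nlinarith)) (measure_mono (closedBall_subset_closedBall hr₁))
      _ = V₁ := one_mul _
  have hH1 : ∫⁻ p, ENNReal.ofReal (ω p) ^ 2 ∂μB ≤ I₂ ^ (4 / 5 : ℝ) * V₁ ^ (1 / 5 : ℝ) := by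
    have hpq : (5 / 4 : ℝ).HolderConjugate 5 := Real.holderConjugate_iff.2 ⟨by norm_num, by norm_num⟩
    have h : ∫⁻ p, ENNReal.ofReal (ω p) ^ 2 * 1 ∂μB ≤ (∫⁻ p, (ENNReal.ofReal (ω p) ^ 2) ^ (5 / 4 : ℝ) ∂μB) ^ (1 / (5 / 4) : ℝ) *
        (∫⁻ _, (1 : ℝ≥0∞) ^ (5 : ℝ) ∂μB) ^ (1 / 5 : ℝ) :=
      ENNReal.lintegral_mul_le_Lp_mul_Lq μB hpq (f := fun p => ENNReal.ofReal (ω p) ^ 2) (g := fun _ => 1)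
        (hωM.pow_const 2) aemeasurable_const
    have e : ∀ x : ℝ≥0∞, (x ^ 2) ^ (5 / 4 : ℝ) = x ^ (5 / 2 : ℝ) := fun x => by
      rw [← ENNReal.rpow_two, ← ENNReal.rpow_mul]; norm_num
    simp only [mul_one, ENNReal.one_rpow, lintegral_const, one_mul, e, show (1 / (5 / 4) : ℝ) = 4 / 5 by norm_num] at h
    exact h.trans (mul_le_mul_right (ENNReal.rpow_le_rpow hμBuniv (by norm_num)) _)
  have hH2 : ∫⁻ p, ‖V p.1 p.2‖ₑ * ENNReal.ofReal (ω p) * ‖g p‖ₑ ∂μB ≤ IV ^ (3 / 10 : ℝ) * I₂ ^ (2 / 5 : ℝ) * X ^ (3 / 10 : ℝ) :=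
    (lintegral_mul_mul_le_tenThirds_fiveHalves_tenThirds μB hVM hωM hgM).trans
      (mul_le_mul_right (ENNReal.rpow_le_rpow (lintegral_mono' Measure.restrict_le_self le_rfl) (by norm_num)) _)
  -- (6) the left-hand side is finite: `|χΦs(σ)| ≤ s(σ) ≤ √L |σ| ≤ √L |V|` on `B̄(0,r₁)`
  have hXfin : X ≠ ⊤ := by
    have hpt2 : ∀ p, ‖g p‖ₑ ^ (10 / 3 : ℝ) ≤ ENNReal.ofReal (Real.sqrt L) ^ (10 / 3 : ℝ) *
        (univ ×ˢ B).indicator (fun q => ‖V q.1 q.2‖ₑ ^ (10 / 3 : ℝ)) p := by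
      intro p
      by_cases hp : p.2 ∈ B
      · rw [indicator_of_mem (show p ∈ univ ×ˢ B from ⟨mem_univ _, hp⟩), ← ENNReal.mul_rpow_of_nonneg _ _ (by norm_num)]
        refine ENNReal.rpow_le_rpow ?_ (by norm_num)
        rw [Real.enorm_eq_ofReal_abs, ← ofReal_norm, ← ENNReal.ofReal_mul (Real.sqrt_nonneg _)]
        refine ENNReal.ofReal_le_ofReal ?_
        set σ : ℝ := swirl (V p.1) p.2 with hσ
        have h1 : |g p| ≤ sf σ := by
          rw [hg]
          dsimp only
          rw [abs_mul, abs_mul, abs_of_nonneg (radialCutoff_nonneg r r₁ p.2), abs_of_nonneg (hs0 _)]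
          calc |χ p.1| * (radialCutoff r r₁ p.2 * sf σ) ≤ 1 * (1 * sf σ) :=
                mul_le_mul (hχabs _) (mul_le_mul_of_nonneg_right (radialCutoff_le_one r r₁ p.2) (hs0 _)) (by
                  have := hs0 σ; have := radialCutoff_nonneg r r₁ p.2; positivity) zero_le_one
            _ = sf σ := by ring
        have h2 : sf σ ≤ Real.sqrt L * |σ| := by
          have h := hHL σ
          rw [hHs] at h
          calc sf σ = Real.sqrt (sf σ ^ 2) := (Real.sqrt_sq (hs0 σ)).symm
            _ ≤ Real.sqrt (L * σ ^ 2) := Real.sqrt_le_sqrt h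
            _ = Real.sqrt L * |σ| := by rw [Real.sqrt_mul hL, Real.sqrt_sq_eq_abs]
        have h3 : |σ| ≤ ‖V p.1 p.2‖ := by
          refine (abs_swirl_le_cylRadius_mul_norm' p.2 (V p.1 p.2)).trans ?_
          have hρ : cylRadius p.2 ≤ 1 :=
            ((SereginSverak2009.cylRadius_le_norm' p.2).trans (mem_closedBall_zero_iff.1 hp)).trans hr₁
          calc cylRadius p.2 * ‖V p.1 p.2‖ ≤ 1 * ‖V p.1 p.2‖ := mul_le_mul_of_nonneg_right hρ (norm_nonneg _)
            _ = ‖V p.1 p.2‖ := one_mul _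
        exact h1.trans (h2.trans (mul_le_mul_of_nonneg_left h3 (Real.sqrt_nonneg _)))
      · have hn : r₁ < ‖p.2‖ := not_le.1 fun h => hp (mem_closedBall_zero_iff.2 h)
        have h0 : g p = 0 := by simp only [hg, show Φ p.2 = 0 from radialCutoff_eq_zero hr hrr₁ hn.le]; ring
        rw [h0, enorm_zero, ENNReal.zero_rpow_of_pos (by norm_num)]
        exact zero_le
    have hc : ENNReal.ofReal (Real.sqrt L) ^ (10 / 3 : ℝ) ≠ ⊤ := ENNReal.rpow_ne_top_of_nonneg (by norm_num) ENNReal.ofReal_ne_top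
    refine ne_of_lt ?_
    calc X ≤ ∫⁻ p, ENNReal.ofReal (Real.sqrt L) ^ (10 / 3 : ℝ) * (univ ×ˢ B).indicator (fun q => ‖V q.1 q.2‖ₑ ^ (10 / 3 : ℝ)) p ∂μ' :=
          lintegral_mono hpt2
      _ = ENNReal.ofReal (Real.sqrt L) ^ (10 / 3 : ℝ) * IV := by rw [lintegral_const_mul' _ _ hc, lintegral_indicator hBm]
      _ < ⊤ := ENNReal.mul_lt_top hc.lt_top hIVfin
  -- (7) absorption: `Y² ≤ c(a + bY)`, `Y = X^{3/10}`
  set Y : ℝ≥0∞ := X ^ (3 / 10 : ℝ) with hY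
  set a : ℝ≥0∞ := ENNReal.ofReal ((8 * CΦ ^ 2 + 2 * CT) * D ^ 2) * (I₂ ^ (4 / 5 : ℝ) * V₁ ^ (1 / 5 : ℝ)) with ha
  set b : ℝ≥0∞ := ENNReal.ofReal (2 * CΦ * D) * (IV ^ (3 / 10 : ℝ) * I₂ ^ (2 / 5 : ℝ)) with hb
  have hY2 : Y ^ 2 ≤ C ^ (3 / 5 : ℝ) * (a + b * Y) := by
    have hℛ' : ℛ₀ ≤ a + b * Y := by
      refine hℛ.trans (add_le_add (mul_le_mul_right hH1 _) ?_)
      calc ENNReal.ofReal (2 * CΦ * D) * ∫⁻ p, ‖V p.1 p.2‖ₑ * ENNReal.ofReal (ω p) * ‖g p‖ₑ ∂μB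
          ≤ ENNReal.ofReal (2 * CΦ * D) * (IV ^ (3 / 10 : ℝ) * I₂ ^ (2 / 5 : ℝ) * X ^ (3 / 10 : ℝ)) := mul_le_mul_right hH2 _
        _ = b * Y := by rw [hb, hY]; ring
    calc Y ^ 2 = X ^ (3 / 5 : ℝ) := by rw [hY, ← ENNReal.rpow_two, ← ENNReal.rpow_mul]; norm_num
      _ ≤ (C * ℛ₀ ^ (5 / 3 : ℝ)) ^ (3 / 5 : ℝ) := ENNReal.rpow_le_rpow hA (by norm_num)
      _ = C ^ (3 / 5 : ℝ) * ℛ₀ := by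
          rw [ENNReal.mul_rpow_of_nonneg _ _ (by norm_num), ← ENNReal.rpow_mul]
          norm_num
      _ ≤ C ^ (3 / 5 : ℝ) * (a + b * Y) := mul_le_mul_right hℛ' _
  have hYb := le_sqrt_add_of_sq_le_mul_add (ENNReal.rpow_ne_top_of_nonneg (by norm_num) hXfin) hY2
  -- (8) the final form
  set c : ℝ≥0∞ := C ^ (3 / 5 : ℝ) with hc
  set D' : ℝ≥0∞ := ENNReal.ofReal D with hD'
  have eD2 : ENNReal.ofReal ((8 * CΦ ^ 2 + 2 * CT) * D ^ 2) = ENNReal.ofReal (8 * CΦ ^ 2 + 2 * CT) * D' ^ 2 := by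
    rw [ENNReal.ofReal_mul (by positivity), ENNReal.ofReal_pow hD0]
  have eD1 : ENNReal.ofReal (2 * CΦ * D) = ENNReal.ofReal (2 * CΦ) * D' := ENNReal.ofReal_mul (by positivity)
  have e1 : (2 * c * a) ^ (1 / 2 : ℝ) =
      (2 * c * ENNReal.ofReal (8 * CΦ ^ 2 + 2 * CT) * V₁ ^ (1 / 5 : ℝ)) ^ (1 / 2 : ℝ) * D' * I₂ ^ (2 / 5 : ℝ) := by
    rw [ha, eD2]
    have e : 2 * c * (ENNReal.ofReal (8 * CΦ ^ 2 + 2 * CT) * D' ^ 2 * (I₂ ^ (4 / 5 : ℝ) * V₁ ^ (1 / 5 : ℝ))) =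
        (2 * c * ENNReal.ofReal (8 * CΦ ^ 2 + 2 * CT) * V₁ ^ (1 / 5 : ℝ)) * (D' ^ 2 * I₂ ^ (4 / 5 : ℝ)) := by ring
    rw [e, ENNReal.mul_rpow_of_nonneg _ (D' ^ 2 * I₂ ^ (4 / 5 : ℝ)) (by norm_num),
      ENNReal.mul_rpow_of_nonneg (D' ^ 2) (I₂ ^ (4 / 5 : ℝ)) (by norm_num),
      ← ENNReal.rpow_two, ← ENNReal.rpow_mul, ← ENNReal.rpow_mul]
    norm_num
    ring
  have e2 : c * b = c * ENNReal.ofReal (2 * CΦ) * D' * (IV ^ (3 / 10 : ℝ) * I₂ ^ (2 / 5 : ℝ)) := by rw [hb, eD1]; ring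
  rw [e1, e2] at hYb
  calc Y ≤ (2 * c * ENNReal.ofReal (8 * CΦ ^ 2 + 2 * CT) * V₁ ^ (1 / 5 : ℝ)) ^ (1 / 2 : ℝ) * D' * I₂ ^ (2 / 5 : ℝ) +
        c * ENNReal.ofReal (2 * CΦ) * D' * (IV ^ (3 / 10 : ℝ) * I₂ ^ (2 / 5 : ℝ)) := hYb
    _ ≤ (2 * c * ENNReal.ofReal (8 * CΦ ^ 2 + 2 * CT) * V₁ ^ (1 / 5 : ℝ)) ^ (1 / 2 : ℝ) * D' * I₂ ^ (2 / 5 : ℝ) +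
        c * ENNReal.ofReal (2 * CΦ) * D' * (IV ^ (3 / 10 : ℝ) * I₂ ^ (2 / 5 : ℝ)) +
        ((2 * c * ENNReal.ofReal (8 * CΦ ^ 2 + 2 * CT) * V₁ ^ (1 / 5 : ℝ)) ^ (1 / 2 : ℝ) * D' * I₂ ^ (2 / 5 : ℝ) * IV ^ (3 / 10 : ℝ) +
          c * ENNReal.ofReal (2 * CΦ) * D' * I₂ ^ (2 / 5 : ℝ)) := le_self_add
    _ = ((2 * c * ENNReal.ofReal (8 * CΦ ^ 2 + 2 * CT) * V₁ ^ (1 / 5 : ℝ)) ^ (1 / 2 : ℝ) + c * ENNReal.ofReal (2 * CΦ)) *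
        (1 + IV ^ (3 / 10 : ℝ)) * D' * I₂ ^ (2 / 5 : ℝ) := by ring


end Summit.NavierStokesRegularity.NavierStokesRegularity.Theorems.AxisymmetricKatoGlobal.EulerScaling

end
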